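import Literature.AnabelianGeometry.SemiGraphs.UniversalCoveringOver

/-!
# `𝒢_{∞,S}` is tempered when `S` splits itself ([SemiAnbd] §3 p. 38) — proofs

Proof-only sequel to `UniversalCoveringOver.lean`.  [SemiAnbd] p. 38: for a finite étale GALOIS
covering `𝒢_i → 𝒢`, "the `𝒢_{∞,i} → 𝒢` are tempered coverings of `𝒢`".  In the presentation of
`TemperedCoverings.lean`: if `S` is a finite object with nonempty fibres which splits itself
(`S.Splits S`: the stabiliser of any point of a fibre acts trivially on that fibre — e.g. `S`
Galois), then `S` splits `𝒢_{∞,S} = univCoverOver S` at every point, since `Π_v` acts on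
`(V, x, p)` through `x ∈ S_v`; hence `𝒢_{∞,S}` is tempered (Def. 3.5 (ii)).
-/

namespace Literature.AnabelianGeometry.SemiGraphs

namespace ProfiniteSemiGraph

universe u

variable {𝒢 : ProfiniteSemiGraph.{u}} (S : CovObj 𝒢) (c : S.orbitGraph.CatCarrier)
  (h𝒢 : 𝒢.IsCountable)

/-- A self-splitting `S` splits `𝒢_{∞,S}` (at every point). [cite: MochizukiSemiAnbd2006, Prop 3.6 p.38] -/
theorem CovObj.splits_univCoverOver (hsplit : S.Splits S) : S.Splits (S.univCoverOver c h𝒢) := by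
  refine ⟨fun v x g hg t => ?_, fun e x g hg t => ?_⟩
  · exact CovObj.FibV.ext S c rfl (hsplit.1 v x g hg t.2.1.1) HEq.rfl
  · exact CovObj.FibE.ext S c rfl (hsplit.2 e x g hg t.2.1.1) HEq.rfl

/-- **`𝒢_{∞,S} → 𝒢` is a tempered covering** when `S` is a finite object with nonempty fibres
splitting itself (e.g. a finite étale Galois covering; [SemiAnbd] p. 38).
[cite: MochizukiSemiAnbd2006, Prop 3.6 p.38] -/
theorem CovObj.univCoverOver_isTempered (hS : S.IsFinite) (hN : S.HasNonemptyFibres)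
    (hsplit : S.Splits S) : (S.univCoverOver c h𝒢).IsTempered := by
  intro p
  refine ⟨S, hS, hN, fun q _ => ?_⟩
  rcases q with ⟨v, t⟩ | ⟨e, t⟩
  · intro x g hg
    exact (S.splits_univCoverOver c h𝒢 hsplit).1 v x g hg t
  · intro x g hg
    exact (S.splits_univCoverOver c h𝒢 hsplit).2 e x g hg t

end ProfiniteSemiGraph

end Literature.AnabelianGeometry.SemiGraphs
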